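import Summits.RiemannHypothesis.RiemannHypothesis.Theorems.WeilTwoPrimeDeflM80XBase
import Literature.NumberTheory.LFunctions.WeilBlockRows
import Literature.NumberTheory.LFunctions.WeilBlockRowsPZ
import Summits.RiemannHypothesis.RiemannHypothesis.Theorems.WeilTwoPrimeDeflM80PDataDnE18
import HarnessLib

/-!
# Calibration certificate M80X: rows 60–65 of the even `D C = I` and rows 70–73 of the claim `D = Dn / Ls` for M80P's factored even inverse

`WeilCert.checkDCRow 0` (6 rows) and `WeilCert.checkDnRow` (4 rows, `weilCertDeflM80XDnE` / `weilCertDeflM80PLsE`) for certificate M80X, by `decide +kernel` (gen3 re-split: ≤ 6 DC rows per file for the gate's 600-s elaboration cap under the farm's load variance). Pure proof file.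
-/

set_option linter.dupNamespace false

noncomputable section

namespace Summit.RiemannHypothesis.RiemannHypothesis.Theorems.EvenWinsBeyondArch

open Literature.NumberTheory.LFunctions

set_option maxHeartbeats 0 in
/-- Kernel check of row 60 of the even `D C = I` (certificate M80X). [folklore] -/
theorem checkDCRow0_60_weilCertDeflM80X : weilCertDeflM80XBase.checkDCRow 0 60 = true := by
  decide +kernel

set_option maxHeartbeats 0 in
/-- Kernel check of row 61 of the even `D C = I` (certificate M80X). [folklore] -/
theorem checkDCRow0_61_weilCertDeflM80X : weilCertDeflM80XBase.checkDCRow 0 61 = true := by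
  decide +kernel

set_option maxHeartbeats 0 in
/-- Kernel check of row 62 of the even `D C = I` (certificate M80X). [folklore] -/
theorem checkDCRow0_62_weilCertDeflM80X : weilCertDeflM80XBase.checkDCRow 0 62 = true := by
  decide +kernel

set_option maxHeartbeats 0 in
/-- Kernel check of row 63 of the even `D C = I` (certificate M80X). [folklore] -/
theorem checkDCRow0_63_weilCertDeflM80X : weilCertDeflM80XBase.checkDCRow 0 63 = true := by
  decide +kernel

set_option maxHeartbeats 0 in
/-- Kernel check of row 64 of the even `D C = I` (certificate M80X). [folklore] -/
theorem checkDCRow0_64_weilCertDeflM80X : weilCertDeflM80XBase.checkDCRow 0 64 = true := by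
  decide +kernel

set_option maxHeartbeats 0 in
/-- Kernel check of row 65 of the even `D C = I` (certificate M80X). [folklore] -/
theorem checkDCRow0_65_weilCertDeflM80X : weilCertDeflM80XBase.checkDCRow 0 65 = true := by
  decide +kernel

-- ===== factored even inverse `D = Dn / Ls`: rows 70–73 =====
set_option maxHeartbeats 0 in
/-- Row 70 of `DnE/LsE` is row 70 of the even `D` (certificate M80X). [folklore] -/
theorem checkDnRow0_70_weilCertDeflM80X : weilCertDeflM80XBase.checkDnRow weilCertDeflM80XDnE weilCertDeflM80PLsE 0 70 = true := by
  decide +kernel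

set_option maxHeartbeats 0 in
/-- Row 71 of `DnE/LsE` is row 71 of the even `D` (certificate M80X). [folklore] -/
theorem checkDnRow0_71_weilCertDeflM80X : weilCertDeflM80XBase.checkDnRow weilCertDeflM80XDnE weilCertDeflM80PLsE 0 71 = true := by
  decide +kernel

set_option maxHeartbeats 0 in
/-- Row 72 of `DnE/LsE` is row 72 of the even `D` (certificate M80X). [folklore] -/
theorem checkDnRow0_72_weilCertDeflM80X : weilCertDeflM80XBase.checkDnRow weilCertDeflM80XDnE weilCertDeflM80PLsE 0 72 = true := by
  decide +kernel

set_option maxHeartbeats 0 in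
/-- Row 73 of `DnE/LsE` is row 73 of the even `D` (certificate M80X). [folklore] -/
theorem checkDnRow0_73_weilCertDeflM80X : weilCertDeflM80XBase.checkDnRow weilCertDeflM80XDnE weilCertDeflM80PLsE 0 73 = true := by
  decide +kernel

end Summit.RiemannHypothesis.RiemannHypothesis.Theorems.EvenWinsBeyondArch

end
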